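import Summits.AtomisticToContinuum.Crystallization.Theses.ChessboardParticlePlanes
import Summits.AtomisticToContinuum.Crystallization.Theorems.ChessboardParticlePlanesLjPlaneChessboardTransversal
import Summits.AtomisticToContinuum.Crystallization.Theorems.ChessboardParticlePlanesLjPlaneChessboardLayerTransversal
import Summits.AtomisticToContinuum.Crystallization.Theorems.ChessboardParticlePlanesLjPlaneChessboardDeficitInvariant

/-!
# Crux `ChessboardParticlePlanes.LjPlaneChessboard` (stmt-AtomisticToContinuum-6709), line `Sketch`,
# stub `deficit_motif_to_layers` — the motif-summed deficit re-summed over the layer motifs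

Let `Q` be a periodic configuration of `ℝ³` (periods `G = Q.lattice`, motif `Q.motif`, point set
`S = Q.points`) with next / previous occupied height maps `τu`, `τd`, horizontal periods `a, b ∈ G`
generating all horizontal periods over `ℤ`, and a vertical period `g₀ ∈ G` (every period has
height in `(g₀ 2) ℤ`); let the occupied heights be enumerated by a strictly increasing
`z : ℤ → ℝ` with `z (i + n) = z i + g₀ 2` (`n > 0`), and let `F m` be a vertically periodic
presentation of the layers (`F m ⊆ S ∩ {x₂ = z m}` finite, pairwise `ℤa + ℤb`-inequivalent,
`S ∩ {x₂ = z m} = F m + ℤa + ℤb`, `F (m + n) = F m + g₀`).  Write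
`h_T(p) = ∑' y ∈ T ∖ {p}, V_LJ |p − y|` for the site sum of a point set `T`, `R(t, t')` for the
period-2 restack of the layers at heights `t, t'`, and
`d(x) = 2 h_S(x) − h_{R(x₂, τu x₂)}(x) − h_{R(τd x₂, x₂)}(x)` for the per-site chessboard deficit.
CLAIM: `Σ_{x ∈ Q.motif} d(x) = Σ_{i < n} Σ_{x ∈ F i} d(x)`.  [folklore]

PROOF (assembly of three landed facts).  (i) `d` is `G`-invariant on `S`
(`deficitSite_latticeInvariant` of `…LjPlaneChessboardDeficitInvariant.lean`, applied with the
vertical period `w = g₀`, `c₀ = g₀ 2`; here `c₀ > 0` because `z 0 < z n = z 0 + g₀ 2`).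
(ii) By `layerTransversal` the finite set `T = ⋃_{i < n} F i` is a transversal of `S` modulo `G`
and `Σ_{t ∈ T} d t = Σ_{i < n} Σ_{f ∈ F i} d f`.  (iii) By `motifSum_transversal` and (i),
`Σ_{x ∈ Q.motif} d x = Σ_{t ∈ T} d t`.  No definition and no notation is introduced (site sums
and restack sets are written out literally, as in the registered signature).
-/

noncomputable section

namespace Summit.AtomisticToContinuum.Crystallization.Theorems.ChessboardParticlePlanesLjPlaneChessboard

open Literature.MathematicalPhysics.StatisticalMechanics

/-- **Stub `deficit_motif_to_layers` — the motif-summed chessboard deficit re-summed over the layer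
motifs of one vertical period.**  For a periodic configuration `Q` of `ℝ³` with next / previous
occupied height maps `τu`, `τd`, horizontal periods `a, b` generating the horizontal periods over
`ℤ`, a vertical period `g₀` (all period heights in `(g₀ 2) ℤ`), occupied heights `z : ℤ → ℝ`
(strictly increasing, `z (i + n) = z i + g₀ 2`, `n > 0`) and a vertically periodic layer
presentation `F` (`F m`: pairwise `ℤa + ℤb`-inequivalent points of height `z m` whose cosets
exhaust the layer, `F (m + n) = F m + g₀`), the per-site deficit
`d(x) = 2 h_S(x) − h_{R(x₂, τu x₂)}(x) − h_{R(τd x₂, x₂)}(x)` satisfies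
`Σ_{x ∈ Q.motif} d(x) = Σ_{i < n} Σ_{x ∈ F i} d(x)`: `d` is invariant under the period lattice
(`deficitSite_latticeInvariant`, with `w = g₀`, `c₀ = g₀ 2 > 0` since `z 0 < z n = z 0 + g₀ 2`),
`⋃_{i < n} F i` is a transversal of `S` modulo `G` (`layerTransversal`), and a lattice-invariant
function has the same sum over any two transversals (`motifSum_transversal`). [folklore] -/
theorem deficit_motif_to_layers :
    ∀ (Q : PeriodicConfiguration 3) (τu τd : ℝ → ℝ) (a b g₀ : EuclideanSpace ℝ (Fin 3))
      (z : ℤ → ℝ) (n : ℕ) (F : ℤ → Finset (EuclideanSpace ℝ (Fin 3))),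
      (∀ t : ℝ, (∃ x ∈ Q.points, x 2 = t) →
        (t < τu t ∧ (∃ x ∈ Q.points, x 2 = τu t) ∧ (∀ x ∈ Q.points, x 2 ≤ t ∨ τu t ≤ x 2)) ∧
        (τd t < t ∧ (∃ x ∈ Q.points, x 2 = τd t) ∧ (∀ x ∈ Q.points, x 2 ≤ τd t ∨ t ≤ x 2))) →
      a ∈ Q.lattice → b ∈ Q.lattice → a 2 = 0 → b 2 = 0 →
      (∀ g ∈ Q.lattice, g 2 = 0 → ∃ k l : ℤ, g = (k : ℝ) • a + (l : ℝ) • b) →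
      g₀ ∈ Q.lattice → 0 < n → StrictMono z → (∀ i : ℤ, z (i + n) = z i + g₀ 2) →
      (∀ g ∈ Q.lattice, ∃ k : ℤ, g 2 = g₀ 2 * k) →
      (∀ y ∈ Q.points, ∃ i : ℤ, y 2 = z i) →
      (∀ m : ℤ, ∀ f ∈ F m, f 2 = z m ∧ f ∈ Q.points) →
      (∀ m : ℤ, ∀ f ∈ F m, ∀ f' ∈ F m, f ≠ f' → ∀ k l : ℤ, f' ≠ f + (k : ℝ) • a + (l : ℝ) • b) →
      (∀ (m : ℤ) (y : EuclideanSpace ℝ (Fin 3)),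
        (y ∈ Q.points ∧ y 2 = z m) ↔ ∃ f ∈ F m, ∃ k l : ℤ, y = f + (k : ℝ) • a + (l : ℝ) • b) →
      (∀ m : ℤ, F (m + n) = (F m).image (fun f => f + g₀)) →
      ∑ x ∈ Q.motif, (2 * (∑' y : {y : EuclideanSpace ℝ (Fin 3) // y ∈ Q.points ∧ y ≠ x}, lennardJones (dist x y.1))
        - (∑' y : {y : EuclideanSpace ℝ (Fin 3) //
              y ∈ {p : EuclideanSpace ℝ (Fin 3) | ∃ k : ℤ, ∃ x' ∈ Q.points,
                (x' 2 = x 2 ∨ x' 2 = τu (x 2)) ∧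
                p = x' + ((2 * (τu (x 2) - x 2)) * (k : ℝ)) •
                  EuclideanSpace.single (2 : Fin 3) (1 : ℝ)} ∧ y ≠ x},
              lennardJones (dist x y.1))
        - (∑' y : {y : EuclideanSpace ℝ (Fin 3) //
              y ∈ {p : EuclideanSpace ℝ (Fin 3) | ∃ k : ℤ, ∃ x' ∈ Q.points,
                (x' 2 = τd (x 2) ∨ x' 2 = x 2) ∧
                p = x' + ((2 * (x 2 - τd (x 2))) * (k : ℝ)) •
                  EuclideanSpace.single (2 : Fin 3) (1 : ℝ)} ∧ y ≠ x},
              lennardJones (dist x y.1))) =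
      ∑ i₀ ∈ Finset.range n, ∑ x ∈ F i₀, (2 * (∑' y : {y : EuclideanSpace ℝ (Fin 3) // y ∈ Q.points ∧ y ≠ x}, lennardJones (dist x y.1))
        - (∑' y : {y : EuclideanSpace ℝ (Fin 3) //
              y ∈ {p : EuclideanSpace ℝ (Fin 3) | ∃ k : ℤ, ∃ x' ∈ Q.points,
                (x' 2 = x 2 ∨ x' 2 = τu (x 2)) ∧
                p = x' + ((2 * (τu (x 2) - x 2)) * (k : ℝ)) •
                  EuclideanSpace.single (2 : Fin 3) (1 : ℝ)} ∧ y ≠ x},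
              lennardJones (dist x y.1))
        - (∑' y : {y : EuclideanSpace ℝ (Fin 3) //
              y ∈ {p : EuclideanSpace ℝ (Fin 3) | ∃ k : ℤ, ∃ x' ∈ Q.points,
                (x' 2 = τd (x 2) ∨ x' 2 = x 2) ∧
                p = x' + ((2 * (x 2 - τd (x 2))) * (k : ℝ)) •
                  EuclideanSpace.single (2 : Fin 3) (1 : ℝ)} ∧ y ≠ x},
              lennardJones (dist x y.1))) := by
  intro Q τu τd a b g₀ z n F Hτ ha hb ha2 hb2 hgen hg₀ hn hz hzper hvert hheights hF hFinj hFiff hFper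
  -- (ii) the layer motifs of one vertical period form a transversal `T = ⋃_{i < n} F i`
  obtain ⟨hT, hTs, hTc, hsum⟩ := layerTransversal Q a b g₀ z n F ha hb ha2 hb2 hgen hg₀ hn hz hzper
    hvert hheights hF hFinj hFiff hFper
  -- the vertical period has positive height: `z 0 < z n = z 0 + g₀ 2`
  have hc₀ : 0 < g₀ 2 := by
    have h0n : z 0 < z (0 + (n : ℤ)) := hz (by omega)
    rw [hzper 0] at h0n
    linarith
  -- (iii) two transversals, then the disjoint-union sum formula of (ii)
  refine Eq.trans (motifSum_transversal Q _ _ ?_ hT hTs hTc) (hsum _)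
  -- (i) lattice invariance of the per-site deficit
  intro x hx g hg
  exact deficitSite_latticeInvariant Q τu τd g₀ (g₀ 2) Hτ hc₀ hg₀ rfl hvert x hx g hg

end Summit.AtomisticToContinuum.Crystallization.Theorems.ChessboardParticlePlanesLjPlaneChessboard

end
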